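/-
Copyright (c) 2026 the pub-hodgecm-mathlib formalisation cell (harness21).  Prover seat hodgecm-mathlib-LH4-p13 (g2), req620 Track A «(D-RAM) FOUR-FRAME» squad
(heir LEAD F0P3a-plan lineage; dealer LH4-plan lineage; MS ROAD A, Stage B re-keyed on multiplicity — LH4-p11 (g2) RULING 2026-09-04T00:53Z, LH4-p10 (g2) ratified 00:58Z:
generic TOOLS for the polarisation count `n_tv(M) = #(Δ_tv(M) ∕ S_F(M))` of ★ StrataDefs ED. 3).  2026-09-04.
-/
import Summits.HodgeConjecture.HodgeConjecture.Theorems.F0P3cDyRamDiagonalStrataDefs   -- ★ DEFS LEAF, ED. 3 p856283 (LH4-p11 (g2)): `polarisationCosets`, `polarisationCount`; brings ★ TorusDefs (`fixedUnitStabilizer`)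
import HarnessLib

/-!
# Crux `H413`, MS ROAD A, STAGE B (re-keyed) — TOOLS FOR THE POLARISATION COUNT: ONE COSET ⇒ `n = 1`; `m` FREE REPRESENTATIVES ⇒ `n = m`

Cell `hodgecm-mathlib` (D-0151), FLOOR 0, crux item H413 = `stmt-HodgeConjecture-24833`, route of record `HCCMUnconditional`; squad F0∕P3c∕LH4 (req618∕req620).  THEOREMS ONLY
(no `def`, no instance, no notation, no `sorry`, default heartbeats); lane `--supports stmt-HodgeConjecture-24833 --as helper` (count-neutral); LIGHT imports (★ StrataDefs only) so
that every type-2 hand (T-strata: this seat; glued: LH4-p09 (g2) ∕ F0P3-p01 (g31) ∕ LH4-p08 (g2); core-hanging: LH4-p07 (g4); Stage A₂ engine: LH4-p14 (g2) ∕ LH4-p11 (g2)) can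
turn a STRUCTURE theorem «`Δ_tv(M)` = the `S_F(M)`-cosets of these representatives» into the VALUE of ★ `polarisationCount σ ϖ tv M` (LH4-p09's law: `1` on the on-branch and
odd-`ρ` strata, `q` on glued even-`ρ ≥ 2`, `q − 1` at `ρ = 0`, `q − 2` at `H(1)` — REF1 #135, REF5 R5-75∕78, F0P3-p01 00:59Z).

WHAT IS PROVED (any field `K` with valuation, any `N`, any type `tv`).
* `coset_eq_of_mem` — `(D₁u)·S_F(M) = D₁·S_F(M)` for `u ∈ S_F(M)`; `mem_coset_self`.
* `polarisationCosets_eq_singleton_of_forall_unique`, **`polarisationCount_eq_one_of_forall_unique (hex) (huniq) : polarisationCount σ ϖ tv M = 1`** (one coset).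
* **`polarisationCosets_eq_image_of_reps`, `polarisationCount_eq_card_of_reps (reps : Finset _) (hrepsfix) (hΔ) (hfree) : polarisationCount σ ϖ tv M = reps.card`** — the letters
  of LH4-p14 (g2)'s (O2b)-MULT engine M1 (`hΔ : ∀ D fixed non-degenerate, IsVertexLattice σ ϖ (diag D) tv M ↔ ∃ D₁ ∈ reps, ∃ u ∈ S_F(M), D = D₁·u`; `hfree`: distinct representatives
  are not `S_F`-related), so that `reps.card` in M1 IS `polarisationCount` in LH4-p11 (g2)'s ★-to-be OrbitAveraging ED. 2 §6.
* `finsum_mem_mul_eq_of_forall_eq_one` — `Σᶠ_{S} (c M)·w M = Σᶠ_{S} w M` where `c ≡ 1` on `S`.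
HONEST LABEL.  Count-neutral (`--supports`); nothing printed is asserted; (MS) and the census laws stay PROVER TARGETS until the Stage B bricks and B10∕B10₂ land; `HC_CM` is proved only
modulo the 7 printed citations (2 remaining named inputs: hLiu418 = `stmt-HodgeConjecture-24832`, h413 = `stmt-HodgeConjecture-24833`) until rung 0 closes.

## References
* [Kottwitz1986BaseChangeUnits] R. E. Kottwitz, *Base change for unit elements of Hecke algebras*, Compositio Math. 60 (1986), §1 pp. 240–241.
* [Rogawski1990] J. D. Rogawski, *Automorphic Representations of Unitary Groups in Three Variables*, Ann. of Math. Stud. 123 (1990), §4.9 Prop. 4.9.1 (a) p. 55.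
-/

set_option autoImplicit false

noncomputable section

namespace Summit.HodgeConjecture.HodgeConjecture.Cruxes.H413.F0P3cDyRamDiagonalPolarisationCountTools

open Matrix
open Literature.NumberTheory.Automorphic Literature.NumberTheory.Automorphic.HermitianLattice
open Literature.NumberTheory.Automorphic.UnitaryLatticeTree
open Summit.HodgeConjecture.HodgeConjecture.Cruxes.H413.F0P3cDyRamDiagonalTorusDefs
open Summit.HodgeConjecture.HodgeConjecture.Cruxes.H413.F0P3cDyRamDiagonalStrataDefs
open scoped Valued WithZero Matrix MatrixGroups

variable {K : Type*} [Field K] [Valued K ℤᵐ⁰] {N : ℕ}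

/-! ## §1  Cosets -/

/-- The `S_F(M)`-coset of `D = D₁·u` is the `S_F(M)`-coset of `D₁` when `u ∈ S_F(M)`. [cite: Kottwitz1986BaseChangeUnits, §1 pp. 240–241] -/
theorem coset_eq_of_mem {σ : K →+* K} {M : Submodule 𝒪[K] (Fin N → K)} {D₁ D : Fin N → K} {u : Fin N → Kˣ}
    (hu : u ∈ fixedUnitStabilizer σ M) (hD : ∀ i, D i = D₁ i * (u i : K)) :
    {D' : Fin N → K | ∃ u' ∈ fixedUnitStabilizer σ M, ∀ i, D' i = D i * ((u' i : Kˣ) : K)} =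
      {D' : Fin N → K | ∃ u' ∈ fixedUnitStabilizer σ M, ∀ i, D' i = D₁ i * ((u' i : Kˣ) : K)} := by
  ext D'
  constructor
  · rintro ⟨u', hu', h'⟩
    refine ⟨u * u', mul_mem hu hu', fun i => ?_⟩
    rw [h' i, hD i, Pi.mul_apply, Units.val_mul, mul_assoc]
  · rintro ⟨u', hu', h'⟩
    refine ⟨u⁻¹ * u', mul_mem (inv_mem hu) hu', fun i => ?_⟩
    rw [h' i, hD i, Pi.mul_apply, Pi.inv_apply, Units.val_mul, mul_assoc, Units.mul_inv_cancel_left]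

/-- `D` lies in its own `S_F(M)`-coset (`u = 1`). [cite: Kottwitz1986BaseChangeUnits, §1 pp. 240–241] -/
theorem mem_coset_self (σ : K →+* K) (M : Submodule 𝒪[K] (Fin N → K)) (D : Fin N → K) :
    D ∈ {D' : Fin N → K | ∃ u' ∈ fixedUnitStabilizer σ M, ∀ i, D' i = D i * ((u' i : Kˣ) : K)} :=
  ⟨1, one_mem _, fun i => by rw [Pi.one_apply, Units.val_one, mul_one]⟩

/-! ## §2  One coset ⇒ `polarisationCount = 1` -/

/-- **ONE COSET**: if `D₀` is a type-`tv` polarisation of `M` and any two polarisations differ by an element of `S_F(M)`, then `Δ_tv(M)∕S_F(M) = {D₀·S_F(M)}`.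
[cite: Kottwitz1986BaseChangeUnits, §1 pp. 240–241] -/
theorem polarisationCosets_eq_singleton_of_forall_unique {σ : K →+* K} {ϖ : K} {tv : ℕ} {M : Submodule 𝒪[K] (Fin N → K)} {D₀ : Fin N → K}
    (hD₀ : ∀ i, σ (D₀ i) = D₀ i ∧ D₀ i ≠ 0) (hV₀ : IsVertexLattice σ ϖ (Matrix.diagonal D₀) tv M)
    (huniq : ∀ D₁ D : Fin N → K, (∀ i, σ (D₁ i) = D₁ i ∧ D₁ i ≠ 0) → IsVertexLattice σ ϖ (Matrix.diagonal D₁) tv M →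
      (∀ i, σ (D i) = D i ∧ D i ≠ 0) → IsVertexLattice σ ϖ (Matrix.diagonal D) tv M → ∃ u ∈ fixedUnitStabilizer σ M, ∀ i, D i = D₁ i * (u i : K)) :
    polarisationCosets σ ϖ tv M = {{D' : Fin N → K | ∃ u ∈ fixedUnitStabilizer σ M, ∀ i, D' i = D₀ i * ((u i : Kˣ) : K)}} := by
  refine Set.eq_singleton_iff_unique_mem.2 ⟨(mem_polarisationCosets_iff σ ϖ tv M _).2 ⟨D₀, ⟨hD₀, hV₀⟩, rfl⟩, fun C hC => ?_⟩
  obtain ⟨D, ⟨hD, hV⟩, rfl⟩ := (mem_polarisationCosets_iff σ ϖ tv M C).1 hC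
  obtain ⟨u, hu, hDu⟩ := huniq D₀ D hD₀ hV₀ hD hV
  exact coset_eq_of_mem hu hDu

/-- **ONE COSET ⇒ `polarisationCount = 1`.** [cite: Kottwitz1986BaseChangeUnits, §1 pp. 240–241] -/
theorem polarisationCount_eq_one_of_forall_unique {σ : K →+* K} {ϖ : K} {tv : ℕ} {M : Submodule 𝒪[K] (Fin N → K)}
    (hex : ∃ D : Fin N → K, (∀ i, σ (D i) = D i ∧ D i ≠ 0) ∧ IsVertexLattice σ ϖ (Matrix.diagonal D) tv M)
    (huniq : ∀ D₁ D : Fin N → K, (∀ i, σ (D₁ i) = D₁ i ∧ D₁ i ≠ 0) → IsVertexLattice σ ϖ (Matrix.diagonal D₁) tv M →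
      (∀ i, σ (D i) = D i ∧ D i ≠ 0) → IsVertexLattice σ ϖ (Matrix.diagonal D) tv M → ∃ u ∈ fixedUnitStabilizer σ M, ∀ i, D i = D₁ i * (u i : K)) :
    polarisationCount σ ϖ tv M = 1 := by
  obtain ⟨D₀, hD₀, hV₀⟩ := hex
  rw [polarisationCount_eq, polarisationCosets_eq_singleton_of_forall_unique hD₀ hV₀ huniq, Set.ncard_singleton]

/-! ## §3  `m` free representatives ⇒ `polarisationCount = m` (the letters of the (O2b)-MULT engine) -/

/-- **THE COSETS ARE THE COSETS OF THE REPRESENTATIVES**: if every type-`tv` polarisation is `S_F(M)`-equivalent to a member of `reps` (and the members of `reps` are non-degenerate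
`σ`-fixed), then `Δ_tv(M)∕S_F(M)` is the image of `reps` under `D₁ ↦ D₁·S_F(M)`. [cite: Kottwitz1986BaseChangeUnits, §1 pp. 240–241] [cite: Rogawski1990, §4.9 Prop. 4.9.1 (a) p. 55] -/
theorem polarisationCosets_eq_image_of_reps {σ : K →+* K} {ϖ : K} {tv : ℕ} {M : Submodule 𝒪[K] (Fin N → K)} (reps : Finset (Fin N → K))
    (hrepsfix : ∀ D ∈ reps, ∀ i, σ (D i) = D i ∧ D i ≠ 0)
    (hΔ : ∀ D : Fin N → K, (∀ i, σ (D i) = D i ∧ D i ≠ 0) →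
      (IsVertexLattice σ ϖ (Matrix.diagonal D) tv M ↔ ∃ D₁ ∈ reps, ∃ u ∈ fixedUnitStabilizer σ M, ∀ i, D i = D₁ i * (u i : K))) :
    polarisationCosets σ ϖ tv M =
      (fun D₁ : Fin N → K => {D' : Fin N → K | ∃ u ∈ fixedUnitStabilizer σ M, ∀ i, D' i = D₁ i * ((u i : Kˣ) : K)}) '' (reps : Set (Fin N → K)) := by
  ext C
  rw [mem_polarisationCosets_iff, Set.mem_image]
  constructor
  · rintro ⟨D, ⟨hD, hV⟩, rfl⟩
    obtain ⟨D₁, hD₁, u, hu, hDu⟩ := (hΔ D hD).1 hV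
    exact ⟨D₁, hD₁, (coset_eq_of_mem hu hDu).symm⟩
  · rintro ⟨D₁, hD₁, rfl⟩
    refine ⟨D₁, ⟨hrepsfix D₁ hD₁, (hΔ D₁ (hrepsfix D₁ hD₁)).2 ⟨D₁, hD₁, 1, one_mem _, fun i => ?_⟩⟩, rfl⟩
    rw [Pi.one_apply, Units.val_one, mul_one]

/-- **`m` FREE REPRESENTATIVES ⇒ `polarisationCount = m`**: with `hΔ` as above and `hfree` (distinct members of `reps` are not `S_F(M)`-related), `polarisationCount σ ϖ tv M = reps.card`
— the bridge between LH4-p14 (g2)'s (O2b)-MULT engine (`… = 8·[𝒯 : S̃]·reps.card`) and the re-keyed Stage A₂ head (`… ·polarisationCount σ ϖ tv M₀`).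
[cite: Kottwitz1986BaseChangeUnits, §1 pp. 240–241] [cite: Rogawski1990, §4.9 Prop. 4.9.1 (a) p. 55] -/
theorem polarisationCount_eq_card_of_reps {σ : K →+* K} {ϖ : K} {tv : ℕ} {M : Submodule 𝒪[K] (Fin N → K)} (reps : Finset (Fin N → K))
    (hrepsfix : ∀ D ∈ reps, ∀ i, σ (D i) = D i ∧ D i ≠ 0)
    (hΔ : ∀ D : Fin N → K, (∀ i, σ (D i) = D i ∧ D i ≠ 0) →
      (IsVertexLattice σ ϖ (Matrix.diagonal D) tv M ↔ ∃ D₁ ∈ reps, ∃ u ∈ fixedUnitStabilizer σ M, ∀ i, D i = D₁ i * (u i : K)))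
    (hfree : ∀ D₁ ∈ reps, ∀ D₂ ∈ reps, ∀ u ∈ fixedUnitStabilizer σ M, (∀ i, D₂ i = D₁ i * (u i : K)) → D₁ = D₂) :
    polarisationCount σ ϖ tv M = reps.card := by
  -- the coset map is injective on `reps`
  have hinj : Set.InjOn (fun D₁ : Fin N → K => {D' : Fin N → K | ∃ u ∈ fixedUnitStabilizer σ M, ∀ i, D' i = D₁ i * ((u i : Kˣ) : K)})
      (reps : Set (Fin N → K)) := by
    rintro D₁ hD₁ D₂ hD₂ h
    have h' : {D' : Fin N → K | ∃ u ∈ fixedUnitStabilizer σ M, ∀ i, D' i = D₁ i * ((u i : Kˣ) : K)} =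
        {D' : Fin N → K | ∃ u ∈ fixedUnitStabilizer σ M, ∀ i, D' i = D₂ i * ((u i : Kˣ) : K)} := h
    have hmem : D₂ ∈ {D' : Fin N → K | ∃ u ∈ fixedUnitStabilizer σ M, ∀ i, D' i = D₁ i * ((u i : Kˣ) : K)} := by
      rw [h']; exact mem_coset_self σ M D₂
    obtain ⟨u, hu, hD₂u⟩ := hmem
    exact hfree D₁ hD₁ D₂ hD₂ u hu hD₂u
  rw [polarisationCount_eq, polarisationCosets_eq_image_of_reps reps hrepsfix hΔ, hinj.ncard_image, Set.ncard_coe_finset]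

/-- **NO REPRESENTATIVE NEEDED ⇒ `0`; also: `polarisationCount ≠ 0` forces a polarisation** (contrapositive of ★ `polarisationCount_eq_zero_of_not_exists`).
[cite: Kottwitz1986BaseChangeUnits, §1 pp. 240–241] -/
theorem exists_of_polarisationCount_ne_zero {σ : K →+* K} {ϖ : K} {tv : ℕ} {M : Submodule 𝒪[K] (Fin N → K)} (h : polarisationCount σ ϖ tv M ≠ 0) :
    ∃ D : Fin N → K, (∀ i, σ (D i) = D i ∧ D i ≠ 0) ∧ IsVertexLattice σ ϖ (Matrix.diagonal D) tv M := by
  by_contra hne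
  exact h (polarisationCount_eq_zero_of_not_exists σ ϖ tv M hne)

/-! ## §4  Re-keyed sums where the count is constant -/

/-- A re-keyed sum `Σ (c M)·w M` equals the plain sum `Σ w M` on an index set where `c ≡ 1`. [cite: Kottwitz1986BaseChangeUnits, §1 pp. 240–241] -/
theorem finsum_mem_mul_eq_of_forall_eq_one {S : Set (Submodule 𝒪[K] (Fin N → K))} (c : Submodule 𝒪[K] (Fin N → K) → ℕ)
    (w : Submodule 𝒪[K] (Fin N → K) → ℚ) (hc : ∀ M ∈ S, c M = 1) :
    ∑ᶠ M ∈ S, (c M : ℚ) * w M = ∑ᶠ M ∈ S, w M :=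
  finsum_mem_congr rfl fun M hM => by rw [hc M hM, Nat.cast_one, one_mul]

/-- A re-keyed sum `Σ (c M)·w M` equals `m · Σ w M` on an index set where `c ≡ m`. [cite: Kottwitz1986BaseChangeUnits, §1 pp. 240–241] -/
theorem finsum_mem_mul_eq_of_forall_eq {S : Set (Submodule 𝒪[K] (Fin N → K))} (c : Submodule 𝒪[K] (Fin N → K) → ℕ)
    (w : Submodule 𝒪[K] (Fin N → K) → ℚ) (m : ℕ) (hc : ∀ M ∈ S, c M = m) :
    ∑ᶠ M ∈ S, (c M : ℚ) * w M = (m : ℚ) * ∑ᶠ M ∈ S, w M := by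
  rw [mul_finsum_mem (fun M => w M) (m : ℚ)]
  exact finsum_mem_congr rfl fun M hM => by rw [hc M hM]

end Summit.HodgeConjecture.HodgeConjecture.Cruxes.H413.F0P3cDyRamDiagonalPolarisationCountTools

end
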